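/-
Copyright (c) 2026 the pub-hodgecm-mathlib formalisation cell (harness21).  Prover seat hodgecm-mathlib-F0P3a-p09 (g9); dealer LH4-plan (g7) WORD #25 «LAYER C (C3c)»,
2026-09-02.  Count-neutral base layer of the dyadic (D-UNR) column (FINDINGS #6∕#6′∕#17 of the LH4 board); CENSUS-C3-BorelCountsTrace 9b5d35604f8b6f1d §3∕§5.
-/
import Literature.NumberTheory.Automorphic.UnitaryThreeBorelConjugateCongruencesTrace   -- ★ p851957 (C3a): the criterion over `u_m^{(y,z)}`, `(ν,w)` normal form, regimes
import Literature.NumberTheory.Automorphic.UnitaryThreeBorelNormalFormUnramified        -- ★ p851951 (i) LH5-p05: `exists_coe_eq_borel_of_mem_flickerPH'` (datum-free `P_H` coordinates)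
import Literature.NumberTheory.Automorphic.UnitaryThreeBorelCosetCount                  -- ★ A-p03: `natCard_cosets_eq_zero_of_forall_not`, `natCard_cosets_eq_index_of_forall` (2-free CITE)
import HarnessLib

/-!
# Flicker's Prop. 10, LAYER B∕C in the TRACE FRAME: «`p⁻¹ τ p ∈ H^K_m`» for `p ∈ P_H` over `u_m^{(y,z)}`, and the coset counts in the rigid regimes
# (every residue characteristic)

Topic `NumberTheory/Automorphic`; namespace `Literature.NumberTheory.Automorphic.UnitaryGroup`.  THEOREMS ONLY (no definition, no instance, no notation, no
named fact, no `sorry`); kernel lane.  Cell `pub/hodgecm-mathlib`, crux H413 = `stmt-HodgeConjecture-24833`; LAYER C block **(C3c)** of the (D-UNR) type-(1)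
column (dealer LH4-plan (g7) WORD #25; design census `F0/P3a/F0P3a-p09/g9/c3/CENSUS-C3-BorelCountsTrace.v1.md` 9b5d35604f8b6f1d §3 (EXPORT rows `…InertCountJPos`,
`…FixedPointsFinite`) ∕ §5, this seat).  Twin of ★ `Automorphic/UnitaryThreeBorelCosetCount` §2–§3 (A-p03 (g24): Flicker's SYMMETRIC corner `!![A,0,B₂ϖ^{2j};0,b,0;B₂,0,A]`,
level element `u_m` with `yσy = −2`, datum `LocalConjDatum` with `|2| = 1`) WITHOUT any of the three: general corner `!![A,0,B₁;0,b,0;B₂,0,D]` with `B₁ = B₂·p`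
(`|p| < 1` resp. `≤ 1` — ★'s `p = ϖ^{2j}`), level element ★ LAYER B 1∕3's `u_m^{(y,z)}` (`|y| = 1`, `|z| ≤ 1`, `z + σz + yσy = 0`), datum ★ `UnramifiedLocalConjDatum` plus the
CHARACTERISTIC token `(h2 : (2 : K) ≠ 0)` (T2) exactly where the Borel normal form of `P_H` is read (★ (i) `exists_coe_eq_borel_of_mem_flickerPH'`).  §1 of ★ (the
normal form itself) is NOT twinned here — it is ★ (i) `UnitaryThreeBorelNormalFormUnramified` (LH5-p05), one object for (C2) and (C3c) (R1 amended).

THE MATHEMATICS [Flicker1998UnitaryFL, Prop. 8 p. 84, Prop. 10 pp. 85–86].  §1″ For `p = p(u,x,w₀) ∈ P_H` and a block element `τ ∈ H` the condition «`p⁻¹ τ p ∈ H^K_m`»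
(★ `flickerHK c u_m^{(y,z)}`) is the four-condition system of ★ (C3a) `borel_conj_mem_unitaryInt_iff_of_rel` in `(ν, x) = (uσu, x)`, equivalently its `(ν, w)` normal form
with `w = x + z` (`borel_conj_mem_flickerHK_iff_of_rel{,_normForm}`).  §2″ Two datum-light ADAPTERS turn any pointwise verdict on the coordinates `(u, x, w₀)` of `P_H`
into a coset count `0` ∕ `[P_H : P_H ∩ H^K_m]` (`natCard_cosets_eq_zero_of_forall_coord_not`, `natCard_cosets_eq_index_of_forall_coord`) — the sockets the (C3b)
`j = 0` kills (LH4-p02) and the (C3e) binder counts plug into without re-reading `P_H`.  §3″ THE COSET COUNT `#{y ∈ P_H ⧸ (P_H ∩ H^K_m) : y⁻¹ τ y ∈ H^K_m}` in the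
rigid regimes, trace frame: `0` when `|t| < |B₂|` («`m > ν`», `natCard_cosets_eq_zero_of_lt_of_rel`); `0` when `|B₂| ≤ |t|` but `|t| < |A − b|` or `|t| < |D − b|`
(`…_of_lt_sub_of_rel` — TWO eigen-congruences because `A ≠ D`); `0` when `|B₂|` strictly dominates (`max(|A−b|,|D−b|) < |B₂|`, `|t|² < |B₂|`; `…_of_max_lt_of_rel`);
`0` when the two linear terms have UNEQUAL sizes dominating (`…_of_ne_of_rel`, generic — for the trace literal `|A − D| ≤ |B₂|` makes the sizes equal whenever they
exceed `|B₂|`, and that EQUAL-SIZE kill reads the literal through T7 `|σb₀ − b₀| = 1`: block (C3b), not here); and the full index when `|A − b|, |D − b|, |B₂| ≤ |t|²`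
(«everything solves», `natCard_cosets_eq_index_of_le_of_rel`).  Conclusions are ★'s byte for byte (`= 0` ∕ `= (…).index`); only binders change.  The remaining regime
`ν = N₊ < 2m` (value `(1+q⁻¹)q^{ν+2m}` through `ρ_m`, ★ `…CosetCountQuadratic`) is block (C3d).
HONEST LABEL: HC_CM is proved only modulo the printed citations (hLiu418 = `stmt-HodgeConjecture-24832`, h413 = `stmt-HodgeConjecture-24833`) until rung 0 closes;
(D-UNR) stays PRINT by D74′; this file is count-neutral group bookkeeping over a valued field, it pays no organ and opens no road.

## References
* [Flicker1998UnitaryFL] Y. Z. Flicker, *Elementary proof of the fundamental lemma for a unitary group*, Canad. J. Math. 50 (1998), 74–98: Prop. 8 p. 84, Prop. 10 pp. 85–86.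
* [Rogawski1990] J. D. Rogawski, *Automorphic Representations of Unitary Groups in Three Variables* (1990), §4.9 p. 55 (the unit orbital integrals being computed).
-/

set_option autoImplicit false

open scoped MatrixGroups WithZero
open Matrix

namespace Literature.NumberTheory.Automorphic

namespace UnitaryGroup

open Literature.NumberTheory.Automorphic.HermitianLattice (unitaryInt mem_unitaryInt_iff UnramifiedLocalConjDatum)

variable {K : Type*} [Field K] [Valued K ℤᵐ⁰] {ϖ : K}
  (σ : K →+* K) {J : Matrix (Fin 3) (Fin 3) K}

/-! ## §1″ «`p⁻¹ τ p ∈ H^K_m`» for `p ∈ P_H` in coordinates, trace frame -/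

/-- **The conjugation condition in coordinates, trace frame**: for `p ∈ H` with matrix `!![u,0,u·x; 0,w₀,0; 0,0,(σu)⁻¹]`, a block element `τ ∈ H` with matrix
`!![A,0,B₁; 0,b,0; B₂,0,D]`, and the level element `u_m^{(y,z)}`: `p⁻¹ τ p ∈ H^K_m` iff the four conditions of ★ (C3a) `borel_conj_mem_unitaryInt_iff_of_rel` hold in
`(ν, x) = (uσu, x)` (twin of ★ `borel_conj_mem_flickerHK_iff`). [cite: Flicker1998UnitaryFL, Prop. 10 pp. 85–86] -/
theorem borel_conj_mem_flickerHK_iff_of_rel (hJ : J = (StdForm.antidiagonal 3).over K) (hd : UnramifiedLocalConjDatum σ ϖ) {y z : K} (hy : Valued.v y = 1)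
    (hz : z + σ z + y * σ y = 0) (m : ℕ)
    {c um p τ : ↥(unitaryGroupOfForm σ J)} {u x w₀ A B₁ B₂ D b : K} (hu : u ≠ 0) (hσu : σ u ≠ 0) (hw₀ : w₀ ≠ 0)
    (hum : ((um : GL (Fin 3) K) : Matrix (Fin 3) (Fin 3) K) = !![ϖ ^ m, y, z * (ϖ ^ m)⁻¹; 0, 1, -σ y * (ϖ ^ m)⁻¹; 0, 0, (ϖ ^ m)⁻¹])
    (hp : ((p : GL (Fin 3) K) : Matrix (Fin 3) (Fin 3) K) = !![u, 0, u * x; 0, w₀, 0; 0, 0, (σ u)⁻¹])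
    (hτ : ((τ : GL (Fin 3) K) : Matrix (Fin 3) (Fin 3) K) = !![A, 0, B₁; 0, b, 0; B₂, 0, D])
    (hpH : p ∈ Subgroup.centralizer ({c} : Set ↥(unitaryGroupOfForm σ J))) (hτH : τ ∈ Subgroup.centralizer ({c} : Set ↥(unitaryGroupOfForm σ J))) :
    p⁻¹ * τ * p ∈ flickerHK σ J c um ↔
      Valued.v ((u * σ u) * B₂) ≤ 1 ∧
      Valued.v (A - b + (u * σ u) * B₂ * (σ z - x)) ≤ Valued.v (ϖ ^ m) ∧
      Valued.v (D - b + (u * σ u) * B₂ * (x + z)) ≤ Valued.v (ϖ ^ m) ∧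
      Valued.v (B₁ * (u * σ u)⁻¹ + (A - b) * (x + z) + (D - b) * (σ z - x) + (u * σ u) * B₂ * ((x + z) * (σ z - x))) ≤
        Valued.v (ϖ ^ m) * Valued.v (ϖ ^ m) := by
  rw [mem_flickerHK_iff]
  have hH : p⁻¹ * τ * p ∈ Subgroup.centralizer ({c} : Set ↥(unitaryGroupOfForm σ J)) :=
    Subgroup.mul_mem _ (Subgroup.mul_mem _ (Subgroup.inv_mem _ hpH) hτH) hpH
  rw [and_iff_right hH]
  exact borel_conj_mem_unitaryInt_iff_of_rel σ hJ hd hy hz m hu hσu hw₀ hum hp hτ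

/-- **The same in the `(ν, w)` normal form** (`ν = uσu`, `w = x + z`, `σx = −x`): `p⁻¹ τ p ∈ H^K_m ↔ |νB₂| ≤ 1 ∧ |A − b + νB₂σw| ≤ |t| ∧ |D − b + νB₂w| ≤ |t| ∧
|B₁ν⁻¹ + (A−b)w + (D−b)σw + νB₂·wσw| ≤ |t|²`. [cite: Flicker1998UnitaryFL, Prop. 10 pp. 85–86] -/
theorem borel_conj_mem_flickerHK_iff_of_rel_normForm (hJ : J = (StdForm.antidiagonal 3).over K) (hd : UnramifiedLocalConjDatum σ ϖ) {y z : K}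
    (hy : Valued.v y = 1) (hz : z + σ z + y * σ y = 0) (m : ℕ)
    {c um p τ : ↥(unitaryGroupOfForm σ J)} {u x w₀ A B₁ B₂ D b : K} (hu : u ≠ 0) (hσu : σ u ≠ 0) (hw₀ : w₀ ≠ 0) (hσx : σ x = -x)
    (hum : ((um : GL (Fin 3) K) : Matrix (Fin 3) (Fin 3) K) = !![ϖ ^ m, y, z * (ϖ ^ m)⁻¹; 0, 1, -σ y * (ϖ ^ m)⁻¹; 0, 0, (ϖ ^ m)⁻¹])
    (hp : ((p : GL (Fin 3) K) : Matrix (Fin 3) (Fin 3) K) = !![u, 0, u * x; 0, w₀, 0; 0, 0, (σ u)⁻¹])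
    (hτ : ((τ : GL (Fin 3) K) : Matrix (Fin 3) (Fin 3) K) = !![A, 0, B₁; 0, b, 0; B₂, 0, D])
    (hpH : p ∈ Subgroup.centralizer ({c} : Set ↥(unitaryGroupOfForm σ J))) (hτH : τ ∈ Subgroup.centralizer ({c} : Set ↥(unitaryGroupOfForm σ J)))
    {w : K} (hw : w = x + z) :
    p⁻¹ * τ * p ∈ flickerHK σ J c um ↔
      Valued.v ((u * σ u) * B₂) ≤ 1 ∧
      Valued.v (A - b + (u * σ u) * B₂ * σ w) ≤ Valued.v (ϖ ^ m) ∧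
      Valued.v (D - b + (u * σ u) * B₂ * w) ≤ Valued.v (ϖ ^ m) ∧
      Valued.v (B₁ * (u * σ u)⁻¹ + (A - b) * w + (D - b) * σ w + (u * σ u) * B₂ * (w * σ w)) ≤ Valued.v (ϖ ^ m) * Valued.v (ϖ ^ m) := by
  rw [mem_flickerHK_iff]
  have hH : p⁻¹ * τ * p ∈ Subgroup.centralizer ({c} : Set ↥(unitaryGroupOfForm σ J)) :=
    Subgroup.mul_mem _ (Subgroup.mul_mem _ (Subgroup.inv_mem _ hpH) hτH) hpH
  rw [and_iff_right hH]
  exact borel_conj_mem_unitaryInt_iff_of_rel_normForm σ hJ hd hy hz m hu hσu hw₀ hσx hum hp hτ hw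

/-! ## §2″ Pointwise verdicts on the coordinates of `P_H` ⇒ coset counts (datum-light adapters) -/

/-- **Adapter «nobody conjugates in» ⇒ count `0`**: if for every `p ∈ P_H`, written `p = !![u,0,u·x;0,w₀,0;0,0,(σu)⁻¹]` with `|u| = 1`, `|x| ≤ 1`, `σx = −x`, `|w₀| = 1`,
`σw₀·w₀ = 1` (★ (i) `exists_coe_eq_borel_of_mem_flickerPH'`), `p⁻¹ τ p ∉ H^K_m`, then `#{y ∈ P_H ⧸ (P_H ∩ H^K_m) : y⁻¹ τ y ∈ H^K_m} = 0` — for ANY level element `um`.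
[cite: Flicker1998UnitaryFL, Prop. 10 p. 85; Prop. 8 p. 84] -/
theorem natCard_cosets_eq_zero_of_forall_coord_not (hJ : J = (StdForm.antidiagonal 3).over K)
    (hσσ : ∀ x, σ (σ x) = x) (hvσ : ∀ x, Valued.v (σ x) = Valued.v x) (h2 : (2 : K) ≠ 0)
    {c um τ : ↥(unitaryGroupOfForm σ J)} (hc : ((c : GL (Fin 3) K) : Matrix (Fin 3) (Fin 3) K) = !![1, 0, 0; 0, -1, 0; 0, 0, 1])
    (h : ∀ p ∈ flickerPH σ J c, ∀ u x w₀ : K,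
      ((p : GL (Fin 3) K) : Matrix (Fin 3) (Fin 3) K) = !![u, 0, u * x; 0, w₀, 0; 0, 0, (σ u)⁻¹] →
        Valued.v u = 1 → Valued.v x ≤ 1 → σ x = -x → Valued.v w₀ = 1 → σ w₀ * w₀ = 1 → p⁻¹ * τ * p ∉ flickerHK σ J c um) :
    Nat.card {y : ↥(flickerPH σ J c) ⧸ (flickerHK σ J c um).subgroupOf (flickerPH σ J c) //
      ((Quotient.out y : ↥(flickerPH σ J c)) : ↥(unitaryGroupOfForm σ J))⁻¹ * τ * (Quotient.out y : ↥(flickerPH σ J c)) ∈ flickerHK σ J c um} = 0 := by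
  refine natCard_cosets_eq_zero_of_forall_not σ fun p hp hmem => ?_
  obtain ⟨u, x, w₀, hpm, hvu, hvx, hσx, hvw, hσw⟩ := exists_coe_eq_borel_of_mem_flickerPH' σ hJ hσσ hvσ h2 hc hp
  exact h p hp u x w₀ hpm hvu hvx hσx hvw hσw hmem

/-- **Adapter «everybody conjugates in» ⇒ count = index**: if for every `p ∈ P_H` with coordinates as above `p⁻¹ τ p ∈ H^K_m`, then the count is `[P_H : P_H ∩ H^K_m]`.
[cite: Flicker1998UnitaryFL, Prop. 10 p. 85; Prop. 8 p. 84] -/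
theorem natCard_cosets_eq_index_of_forall_coord (hJ : J = (StdForm.antidiagonal 3).over K)
    (hσσ : ∀ x, σ (σ x) = x) (hvσ : ∀ x, Valued.v (σ x) = Valued.v x) (h2 : (2 : K) ≠ 0)
    {c um τ : ↥(unitaryGroupOfForm σ J)} (hc : ((c : GL (Fin 3) K) : Matrix (Fin 3) (Fin 3) K) = !![1, 0, 0; 0, -1, 0; 0, 0, 1])
    (h : ∀ p ∈ flickerPH σ J c, ∀ u x w₀ : K,
      ((p : GL (Fin 3) K) : Matrix (Fin 3) (Fin 3) K) = !![u, 0, u * x; 0, w₀, 0; 0, 0, (σ u)⁻¹] →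
        Valued.v u = 1 → Valued.v x ≤ 1 → σ x = -x → Valued.v w₀ = 1 → σ w₀ * w₀ = 1 → p⁻¹ * τ * p ∈ flickerHK σ J c um) :
    Nat.card {y : ↥(flickerPH σ J c) ⧸ (flickerHK σ J c um).subgroupOf (flickerPH σ J c) //
      ((Quotient.out y : ↥(flickerPH σ J c)) : ↥(unitaryGroupOfForm σ J))⁻¹ * τ * (Quotient.out y : ↥(flickerPH σ J c)) ∈ flickerHK σ J c um} =
      ((flickerHK σ J c um).subgroupOf (flickerPH σ J c)).index := by
  refine natCard_cosets_eq_index_of_forall σ fun p hp => ?_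
  obtain ⟨u, x, w₀, hpm, hvu, hvx, hσx, hvw, hσw⟩ := exists_coe_eq_borel_of_mem_flickerPH' σ hJ hσσ hvσ h2 hc hp
  exact h p hp u x w₀ hpm hvu hvx hσx hvw hσw

/-! ## §3″ The coset count in the rigid regimes of Prop. 10, trace frame -/

/-- **The trace-fibre side conditions of a `P_H` coordinate**: for `|x| ≤ 1`, `σx = −x`, `|z| ≤ 1`, `z + σz + yσy = 0`, `|y| = 1` and `w = x + z`:
`|w| ≤ 1`, `|σw| ≤ 1`, `|w| = 1`, `|σw| = 1` and `|w·σw| = 1` (the norm of `w` is a unit because its trace `−yσy` is). [cite: Flicker1998UnitaryFL, Prop. 10 p. 86] -/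
theorem trace_fibre_coord (hd : UnramifiedLocalConjDatum σ ϖ) {y z x : K} (hy : Valued.v y = 1) (hzv : Valued.v z ≤ 1) (hz : z + σ z + y * σ y = 0)
    (hvx : Valued.v x ≤ 1) (hσx : σ x = -x) :
    Valued.v (x + z) ≤ 1 ∧ Valued.v (σ (x + z)) ≤ 1 ∧ Valued.v (x + z) = 1 ∧ Valued.v (σ (x + z)) = 1 ∧ Valued.v ((x + z) * σ (x + z)) = 1 := by
  have hwv : Valued.v (x + z) ≤ 1 := le_trans (Valuation.map_add _ _ _) (max_le hvx hzv)
  have htr : Valued.v ((x + z) + σ (x + z)) = 1 := by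
    have e : (x + z) + σ (x + z) = -(y * σ y) := by rw [map_add, hσx]; linear_combination hz
    rw [e, Valuation.map_neg, map_mul, hd.vσ, hy, mul_one]
  have hw1 : Valued.v (x + z) = 1 := v_eq_one_of_trace_unit σ hd.vσ hwv htr
  have hσw1 : Valued.v (σ (x + z)) = 1 := by rw [hd.vσ, hw1]
  exact ⟨hwv, hσw1.le, hw1, hσw1, v_norm_eq_one_of_trace_unit σ hd.vσ hwv htr⟩

/-- **Regime «`m > ν` is empty» as a coset count, trace frame**: for `τ = !![A,0,B₂p; 0,b,0; B₂,0,D] ∈ H` with `|p| < 1`, `B₂ ≠ 0` and `|ϖ^m| < |B₂|`, NO coset of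
`P_H ∩ H^K_m` in `P_H` conjugates `τ` into `H^K_m` (★ (C3a) `v_B₂_le_of_conditions_normForm`; twin of ★ `natCard_cosets_eq_zero_of_lt`). [cite: Flicker1998UnitaryFL, Prop. 10 p. 86] -/
theorem natCard_cosets_eq_zero_of_lt_of_rel (hJ : J = (StdForm.antidiagonal 3).over K) (hd : UnramifiedLocalConjDatum σ ϖ) (h2 : (2 : K) ≠ 0)
    {y z : K} (hy : Valued.v y = 1) (hzv : Valued.v z ≤ 1) (hz : z + σ z + y * σ y = 0) (m : ℕ)
    {c um τ : ↥(unitaryGroupOfForm σ J)} (hc : ((c : GL (Fin 3) K) : Matrix (Fin 3) (Fin 3) K) = !![1, 0, 0; 0, -1, 0; 0, 0, 1])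
    (hum : ((um : GL (Fin 3) K) : Matrix (Fin 3) (Fin 3) K) = !![ϖ ^ m, y, z * (ϖ ^ m)⁻¹; 0, 1, -σ y * (ϖ ^ m)⁻¹; 0, 0, (ϖ ^ m)⁻¹])
    {A B₁ B₂ D b p : K} (hB₁ : B₁ = B₂ * p) (hvp : Valued.v p < 1) (hB₂0 : B₂ ≠ 0)
    (hτ : ((τ : GL (Fin 3) K) : Matrix (Fin 3) (Fin 3) K) = !![A, 0, B₁; 0, b, 0; B₂, 0, D])
    (hτH : τ ∈ Subgroup.centralizer ({c} : Set ↥(unitaryGroupOfForm σ J))) (hlt : Valued.v (ϖ ^ m) < Valued.v B₂) :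
    Nat.card {y : ↥(flickerPH σ J c) ⧸ (flickerHK σ J c um).subgroupOf (flickerPH σ J c) //
      ((Quotient.out y : ↥(flickerPH σ J c)) : ↥(unitaryGroupOfForm σ J))⁻¹ * τ * (Quotient.out y : ↥(flickerPH σ J c)) ∈ flickerHK σ J c um} = 0 := by
  refine natCard_cosets_eq_zero_of_forall_coord_not σ hJ hd.σσ hd.vσ h2 hc fun p hp u x w₀ hpm hvu hvx hσx hvw _ hmem => ?_
  have hu0 : u ≠ 0 := fun h => by rw [h, map_zero] at hvu; exact zero_ne_one hvu
  have hσu0 : σ u ≠ 0 := fun h => hu0 (by rw [← hd.σσ u, h, map_zero])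
  have hw0 : w₀ ≠ 0 := fun h => by rw [h, map_zero] at hvw; exact zero_ne_one hvw
  have hpH : p ∈ Subgroup.centralizer ({c} : Set ↥(unitaryGroupOfForm σ J)) := ((mem_flickerPH_iff h2 hc).1 hp).1.1
  obtain ⟨-, h₂, h₃, h₄⟩ := (borel_conj_mem_flickerHK_iff_of_rel_normForm σ hJ hd hy hz m hu0 hσu0 hw0 hσx hum hpm hτ hpH hτH rfl).1 hmem
  have hn : Valued.v (u * σ u) = 1 := by rw [map_mul, hd.vσ, hvu, mul_one]
  obtain ⟨hwv, -, -, -, hN⟩ := trace_fibre_coord σ hd hy hzv hz hvx hσx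
  have := v_B₂_le_of_conditions_normForm σ hd hB₂0 hn hwv hN hB₁ hvp h₂ h₃ h₄
  exact absurd hlt (not_lt.2 this)

/-- **Regime «no solution — an eigen-congruence fails» as a coset count, trace frame**: `|B₂| ≤ |t|` (`m ≤ ν`) but `|t| < |A − b|` OR `|t| < |D − b|`: the count is `0`
((2′)(3′) with `|B₂| ≤ |t|` are the two congruences `|A − b| ≤ |t|`, `|D − b| ≤ |t|`, ★ (C3a) `conditions_two_three_iff_of_v_B₂_le`; first half of the twin of ★
`natCard_cosets_eq_zero_of_ne`). [cite: Flicker1998UnitaryFL, Prop. 10 p. 86] -/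
theorem natCard_cosets_eq_zero_of_lt_sub_of_rel (hJ : J = (StdForm.antidiagonal 3).over K) (hd : UnramifiedLocalConjDatum σ ϖ) (h2 : (2 : K) ≠ 0)
    {y z : K} (hy : Valued.v y = 1) (hzv : Valued.v z ≤ 1) (hz : z + σ z + y * σ y = 0) (m : ℕ)
    {c um τ : ↥(unitaryGroupOfForm σ J)} (hc : ((c : GL (Fin 3) K) : Matrix (Fin 3) (Fin 3) K) = !![1, 0, 0; 0, -1, 0; 0, 0, 1])
    (hum : ((um : GL (Fin 3) K) : Matrix (Fin 3) (Fin 3) K) = !![ϖ ^ m, y, z * (ϖ ^ m)⁻¹; 0, 1, -σ y * (ϖ ^ m)⁻¹; 0, 0, (ϖ ^ m)⁻¹])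
    {A B₁ B₂ D b : K}
    (hτ : ((τ : GL (Fin 3) K) : Matrix (Fin 3) (Fin 3) K) = !![A, 0, B₁; 0, b, 0; B₂, 0, D])
    (hτH : τ ∈ Subgroup.centralizer ({c} : Set ↥(unitaryGroupOfForm σ J))) (hB₂m : Valued.v B₂ ≤ Valued.v (ϖ ^ m))
    (hbad : Valued.v (ϖ ^ m) < Valued.v (A - b) ∨ Valued.v (ϖ ^ m) < Valued.v (D - b)) :
    Nat.card {y : ↥(flickerPH σ J c) ⧸ (flickerHK σ J c um).subgroupOf (flickerPH σ J c) //
      ((Quotient.out y : ↥(flickerPH σ J c)) : ↥(unitaryGroupOfForm σ J))⁻¹ * τ * (Quotient.out y : ↥(flickerPH σ J c)) ∈ flickerHK σ J c um} = 0 := by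
  refine natCard_cosets_eq_zero_of_forall_coord_not σ hJ hd.σσ hd.vσ h2 hc fun p hp u x w₀ hpm hvu hvx hσx hvw _ hmem => ?_
  have hu0 : u ≠ 0 := fun h => by rw [h, map_zero] at hvu; exact zero_ne_one hvu
  have hσu0 : σ u ≠ 0 := fun h => hu0 (by rw [← hd.σσ u, h, map_zero])
  have hw0 : w₀ ≠ 0 := fun h => by rw [h, map_zero] at hvw; exact zero_ne_one hvw
  have hpH : p ∈ Subgroup.centralizer ({c} : Set ↥(unitaryGroupOfForm σ J)) := ((mem_flickerPH_iff h2 hc).1 hp).1.1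
  obtain ⟨-, h₂, h₃, -⟩ := (borel_conj_mem_flickerHK_iff_of_rel_normForm σ hJ hd hy hz m hu0 hσu0 hw0 hσx hum hpm hτ hpH hτH rfl).1 hmem
  have hn : Valued.v (u * σ u) = 1 := by rw [map_mul, hd.vσ, hvu, mul_one]
  obtain ⟨hwv, hσwv, -, -, -⟩ := trace_fibre_coord σ hd hy hzv hz hvx hσx
  obtain ⟨hA, hD⟩ := (conditions_two_three_iff_of_v_B₂_le σ hB₂m hn hwv hσwv).1 ⟨h₂, h₃⟩
  rcases hbad with hs | hs
  · exact absurd hs (not_lt.2 hA)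
  · exact absurd hs (not_lt.2 hD)

/-- **Regime «no solution — `|B₂|` dominates (4′)» as a coset count, trace frame**: `τ = !![A,0,B₂p; 0,b,0; B₂,0,D]`, `|p| < 1`, `B₂ ≠ 0`, `max(|A − b|, |D − b|) < |B₂|`
and `|t|² < |B₂|`: the count is `0` (★ (C3a) `not_condition_four_of_lt_normForm`: the norm term `νB₂·N(w)` has valuation `|B₂|`; second half of the twin of ★
`natCard_cosets_eq_zero_of_ne`, case `|A − b| < |B₂|`). [cite: Flicker1998UnitaryFL, Prop. 10 p. 86] -/
theorem natCard_cosets_eq_zero_of_max_lt_of_rel (hJ : J = (StdForm.antidiagonal 3).over K) (hd : UnramifiedLocalConjDatum σ ϖ) (h2 : (2 : K) ≠ 0)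
    {y z : K} (hy : Valued.v y = 1) (hzv : Valued.v z ≤ 1) (hz : z + σ z + y * σ y = 0) (m : ℕ)
    {c um τ : ↥(unitaryGroupOfForm σ J)} (hc : ((c : GL (Fin 3) K) : Matrix (Fin 3) (Fin 3) K) = !![1, 0, 0; 0, -1, 0; 0, 0, 1])
    (hum : ((um : GL (Fin 3) K) : Matrix (Fin 3) (Fin 3) K) = !![ϖ ^ m, y, z * (ϖ ^ m)⁻¹; 0, 1, -σ y * (ϖ ^ m)⁻¹; 0, 0, (ϖ ^ m)⁻¹])
    {A B₁ B₂ D b p : K} (hB₁ : B₁ = B₂ * p) (hvp : Valued.v p < 1) (hB₂0 : B₂ ≠ 0)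
    (hτ : ((τ : GL (Fin 3) K) : Matrix (Fin 3) (Fin 3) K) = !![A, 0, B₁; 0, b, 0; B₂, 0, D])
    (hτH : τ ∈ Subgroup.centralizer ({c} : Set ↥(unitaryGroupOfForm σ J)))
    (hlt : max (Valued.v (A - b)) (Valued.v (D - b)) < Valued.v B₂) (hbig : Valued.v (ϖ ^ m) * Valued.v (ϖ ^ m) < Valued.v B₂) :
    Nat.card {y : ↥(flickerPH σ J c) ⧸ (flickerHK σ J c um).subgroupOf (flickerPH σ J c) //
      ((Quotient.out y : ↥(flickerPH σ J c)) : ↥(unitaryGroupOfForm σ J))⁻¹ * τ * (Quotient.out y : ↥(flickerPH σ J c)) ∈ flickerHK σ J c um} = 0 := by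
  refine natCard_cosets_eq_zero_of_forall_coord_not σ hJ hd.σσ hd.vσ h2 hc fun p hp u x w₀ hpm hvu hvx hσx hvw _ hmem => ?_
  have hu0 : u ≠ 0 := fun h => by rw [h, map_zero] at hvu; exact zero_ne_one hvu
  have hσu0 : σ u ≠ 0 := fun h => hu0 (by rw [← hd.σσ u, h, map_zero])
  have hw0 : w₀ ≠ 0 := fun h => by rw [h, map_zero] at hvw; exact zero_ne_one hvw
  have hpH : p ∈ Subgroup.centralizer ({c} : Set ↥(unitaryGroupOfForm σ J)) := ((mem_flickerPH_iff h2 hc).1 hp).1.1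
  obtain ⟨-, -, -, h₄⟩ := (borel_conj_mem_flickerHK_iff_of_rel_normForm σ hJ hd hy hz m hu0 hσu0 hw0 hσx hum hpm hτ hpH hτH rfl).1 hmem
  have hn : Valued.v (u * σ u) = 1 := by rw [map_mul, hd.vσ, hvu, mul_one]
  obtain ⟨hwv, hσwv, -, -, hN⟩ := trace_fibre_coord σ hd hy hzv hz hvx hσx
  exact not_condition_four_of_lt_normForm σ hB₂0 hn hwv hσwv hN hB₁ hvp hlt hbig h₄

/-- **Regime «no solution — unequal linear sizes dominate (4′)» as a coset count, trace frame** (generic): `τ = !![A,0,B₂p; 0,b,0; B₂,0,D]`, `|p| ≤ 1`,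
`|A − b| ≠ |D − b|`, `|B₂| < max(|A − b|, |D − b|)` and `|t|² < max(|A − b|, |D − b|)`: the count is `0` (★ (C3a) `not_condition_four_of_ne_normForm`).  For the trace LITERAL
`|A − D| ≤ |B₂|` forces EQUAL sizes in this range, so its kill is the equal-size lemma of block (C3b) under T7; this generic half is recorded for completeness of the twin of ★
`natCard_cosets_eq_zero_of_ne`. [cite: Flicker1998UnitaryFL, Prop. 10 p. 86] -/
theorem natCard_cosets_eq_zero_of_ne_of_rel (hJ : J = (StdForm.antidiagonal 3).over K) (hd : UnramifiedLocalConjDatum σ ϖ) (h2 : (2 : K) ≠ 0)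
    {y z : K} (hy : Valued.v y = 1) (hzv : Valued.v z ≤ 1) (hz : z + σ z + y * σ y = 0) (m : ℕ)
    {c um τ : ↥(unitaryGroupOfForm σ J)} (hc : ((c : GL (Fin 3) K) : Matrix (Fin 3) (Fin 3) K) = !![1, 0, 0; 0, -1, 0; 0, 0, 1])
    (hum : ((um : GL (Fin 3) K) : Matrix (Fin 3) (Fin 3) K) = !![ϖ ^ m, y, z * (ϖ ^ m)⁻¹; 0, 1, -σ y * (ϖ ^ m)⁻¹; 0, 0, (ϖ ^ m)⁻¹])
    {A B₁ B₂ D b p : K} (hB₁ : B₁ = B₂ * p) (hvp : Valued.v p ≤ 1)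
    (hτ : ((τ : GL (Fin 3) K) : Matrix (Fin 3) (Fin 3) K) = !![A, 0, B₁; 0, b, 0; B₂, 0, D])
    (hτH : τ ∈ Subgroup.centralizer ({c} : Set ↥(unitaryGroupOfForm σ J)))
    (hne : Valued.v (A - b) ≠ Valued.v (D - b)) (hB₂ : Valued.v B₂ < max (Valued.v (A - b)) (Valued.v (D - b)))
    (hbig : Valued.v (ϖ ^ m) * Valued.v (ϖ ^ m) < max (Valued.v (A - b)) (Valued.v (D - b))) :
    Nat.card {y : ↥(flickerPH σ J c) ⧸ (flickerHK σ J c um).subgroupOf (flickerPH σ J c) //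
      ((Quotient.out y : ↥(flickerPH σ J c)) : ↥(unitaryGroupOfForm σ J))⁻¹ * τ * (Quotient.out y : ↥(flickerPH σ J c)) ∈ flickerHK σ J c um} = 0 := by
  refine natCard_cosets_eq_zero_of_forall_coord_not σ hJ hd.σσ hd.vσ h2 hc fun p hp u x w₀ hpm hvu hvx hσx hvw _ hmem => ?_
  have hu0 : u ≠ 0 := fun h => by rw [h, map_zero] at hvu; exact zero_ne_one hvu
  have hσu0 : σ u ≠ 0 := fun h => hu0 (by rw [← hd.σσ u, h, map_zero])
  have hw0 : w₀ ≠ 0 := fun h => by rw [h, map_zero] at hvw; exact zero_ne_one hvw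
  have hpH : p ∈ Subgroup.centralizer ({c} : Set ↥(unitaryGroupOfForm σ J)) := ((mem_flickerPH_iff h2 hc).1 hp).1.1
  obtain ⟨-, -, -, h₄⟩ := (borel_conj_mem_flickerHK_iff_of_rel_normForm σ hJ hd hy hz m hu0 hσu0 hw0 hσx hum hpm hτ hpH hτH rfl).1 hmem
  have hn : Valued.v (u * σ u) = 1 := by rw [map_mul, hd.vσ, hvu, mul_one]
  obtain ⟨-, -, hw1, hσw1, -⟩ := trace_fibre_coord σ hd hy hzv hz hvx hσx
  exact not_condition_four_of_ne_normForm σ hn hw1 hσw1 hB₁ hvp hne hB₂ hbig h₄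

/-- **Regime «everything solves» as a coset count, trace frame**: `τ = !![A,0,B₂p; 0,b,0; B₂,0,D] ∈ H` with `|p| ≤ 1`, and `|A − b| ≤ |t|²`, `|D − b| ≤ |t|²`,
`|B₂| ≤ |t|²` (`2m ≤ N₊`-type bounds on BOTH eigen-differences, `2m ≤ ν`): EVERY coset conjugates `τ` into `H^K_m`, the count is `[P_H : P_H ∩ H^K_m]` (★ (C3a)
`conditions_two_three_iff_of_v_B₂_le`, `condition_four_of_le_sq_normForm`; twin of ★ `natCard_cosets_eq_index_of_le`). [cite: Flicker1998UnitaryFL, Prop. 10 p. 86; Prop. 8 p. 84] -/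
theorem natCard_cosets_eq_index_of_le_of_rel (hJ : J = (StdForm.antidiagonal 3).over K) (hd : UnramifiedLocalConjDatum σ ϖ) (h2 : (2 : K) ≠ 0)
    {y z : K} (hy : Valued.v y = 1) (hzv : Valued.v z ≤ 1) (hz : z + σ z + y * σ y = 0) (m : ℕ)
    {c um τ : ↥(unitaryGroupOfForm σ J)} (hc : ((c : GL (Fin 3) K) : Matrix (Fin 3) (Fin 3) K) = !![1, 0, 0; 0, -1, 0; 0, 0, 1])
    (hum : ((um : GL (Fin 3) K) : Matrix (Fin 3) (Fin 3) K) = !![ϖ ^ m, y, z * (ϖ ^ m)⁻¹; 0, 1, -σ y * (ϖ ^ m)⁻¹; 0, 0, (ϖ ^ m)⁻¹])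
    {A B₁ B₂ D b p : K} (hB₁ : B₁ = B₂ * p) (hvp : Valued.v p ≤ 1)
    (hτ : ((τ : GL (Fin 3) K) : Matrix (Fin 3) (Fin 3) K) = !![A, 0, B₁; 0, b, 0; B₂, 0, D])
    (hτH : τ ∈ Subgroup.centralizer ({c} : Set ↥(unitaryGroupOfForm σ J)))
    (hsA : Valued.v (A - b) ≤ Valued.v (ϖ ^ m) * Valued.v (ϖ ^ m)) (hsD : Valued.v (D - b) ≤ Valued.v (ϖ ^ m) * Valued.v (ϖ ^ m))
    (hB₂ : Valued.v B₂ ≤ Valued.v (ϖ ^ m) * Valued.v (ϖ ^ m)) :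
    Nat.card {y : ↥(flickerPH σ J c) ⧸ (flickerHK σ J c um).subgroupOf (flickerPH σ J c) //
      ((Quotient.out y : ↥(flickerPH σ J c)) : ↥(unitaryGroupOfForm σ J))⁻¹ * τ * (Quotient.out y : ↥(flickerPH σ J c)) ∈ flickerHK σ J c um} =
      ((flickerHK σ J c um).subgroupOf (flickerPH σ J c)).index := by
  have ht1 : Valued.v (ϖ ^ m) ≤ 1 := hd.v_pow_le_one m
  have ht2 : Valued.v (ϖ ^ m) * Valued.v (ϖ ^ m) ≤ Valued.v (ϖ ^ m) := by simpa using mul_le_mul' ht1 (le_refl (Valued.v (ϖ ^ m)))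
  refine natCard_cosets_eq_index_of_forall_coord σ hJ hd.σσ hd.vσ h2 hc fun p hp u x w₀ hpm hvu hvx hσx hvw _ => ?_
  have hu0 : u ≠ 0 := fun h => by rw [h, map_zero] at hvu; exact zero_ne_one hvu
  have hσu0 : σ u ≠ 0 := fun h => hu0 (by rw [← hd.σσ u, h, map_zero])
  have hw0 : w₀ ≠ 0 := fun h => by rw [h, map_zero] at hvw; exact zero_ne_one hvw
  have hpH : p ∈ Subgroup.centralizer ({c} : Set ↥(unitaryGroupOfForm σ J)) := ((mem_flickerPH_iff h2 hc).1 hp).1.1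
  have hn : Valued.v (u * σ u) = 1 := by rw [map_mul, hd.vσ, hvu, mul_one]
  obtain ⟨hwv, hσwv, -, -, -⟩ := trace_fibre_coord σ hd hy hzv hz hvx hσx
  have hB₂m : Valued.v B₂ ≤ Valued.v (ϖ ^ m) := le_trans hB₂ ht2
  refine (borel_conj_mem_flickerHK_iff_of_rel_normForm σ hJ hd hy hz m hu0 hσu0 hw0 hσx hum hpm hτ hpH hτH rfl).2 ⟨?_, ?_⟩
  · rw [map_mul, hn, one_mul]; exact le_trans hB₂m ht1
  obtain ⟨h₂, h₃⟩ := (conditions_two_three_iff_of_v_B₂_le σ hB₂m hn hwv hσwv).2 ⟨le_trans hsA ht2, le_trans hsD ht2⟩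
  exact ⟨h₂, h₃, condition_four_of_le_sq_normForm σ hn hwv hσwv hB₁ hvp hsA hsD hB₂⟩

end UnitaryGroup

end Literature.NumberTheory.Automorphic
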